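import Literature.NumberTheory.GaloisRepresentations.LubinTateColemanRelativeInterpolationTwo
import HarnessLib

/-!
# The relative Coleman power series `g_β ∈ 𝒪_E⟦X⟧` of a norm-coherent sequence of units along `E·K_π^{m+1}`
# (de Shalit I §2.2 Theorem, Cor. 2.3 (i)–(ii), unramified base, `q = 2`): the map `β ↦ g_β` and its first properties

De Shalit, *Iwasawa theory of elliptic curves with complex multiplication* (1987), Ch. I §2.2–2.3, over the unramified base
`k' = E ⊆ F^{nr}` (finite Galois over `F`), Lubin–Tate group of `f = πX + X²`, Frobenius `φ` of `𝒪_E` (restriction of an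
arithmetic Frobenius `σ₀ ∈ Γ_F`).  Packaging of `LubinTateColemanRelativeInterpolationTwo`:

* `RelNormCoherentUnits hπ E` — sequences `β = (β_m)`, `β_m ∈ 𝒪_{E·K_π^{m+1}}^×`, with
  `N_{E·K_π^{m+1}/E·K_π^{n+1}} β_m = β_n` (Mathlib's `Algebra.norm` for the tower algebra); `mul`, `one`;
  `isRelNormCoherent` — the stabiliser-product form (`algebraMap_towerNorm_sup_eq_prod_relStab`).
* `relColemanSeries` — **Coleman's power series `g_β ∈ 𝒪_E⟦X⟧`**: ★ `evS_relColemanSeries` (`((φ⁻¹)^{m+1} g_β)^ι(ω_{m+1}) = β_m`),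
  ★ `relNormTwo_relColemanSeries` (**`𝒩_E g_β = g_β^φ`**, Cor. 2.3 (ii)), `eq_relColemanSeries` (uniqueness),
  `isUnit_constantCoeff_relColemanSeries` (`g_β ∈ 𝒪_E⟦X⟧^×`), ★ `relColemanSeries_mul` (**`g_{ββ'} = g_β g_{β'}`**, Cor. 2.3 (i)),
  `relColemanSeries_one`.

## References

* E. de Shalit, *Iwasawa theory of elliptic curves with complex multiplication* (1987), Ch. I §2.2 Theorem, §2.3 Cor. (i), (ii). [deShalit1987]
* R. Coleman, *Division values in local fields*, Invent. Math. 53 (1979), Thm. A, Cor. 14.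
-/

noncomputable section

open Filter Topology
open scoped PowerSeries.WithPiTopology

namespace Literature.NumberTheory.GaloisRepresentations

section RelativeSeriesTwo

open GaloisRepresentations.IsNonarchimedeanLocalField LubinTate ValuativeRel Field

variable {F : Type} [Field F] [ValuativeRel F] [TopologicalSpace F] [IsNonarchimedeanLocalField F]

attribute [local instance] ltNormUniformSpace ltNormIsUniformAddGroup rk1 nF nE fintypeResidueField

variable {π : 𝒪[F]} (hπ : (valuation F).IsUniformizer (π : F))
variable (E : IntermediateField F (AlgebraicClosure F)) [FiniteDimensional F E]

/-! ### Norm-coherent sequences of units along `E·K_π^{m+1}` -/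

/-- **A norm-coherent sequence of units along the tower `E·K_π^{m+1}`** (`m ≥ 0`): `β_m ∈ 𝒪_{E·K_π^{m+1}}^×` with
`N_{E·K_π^{m+1}/E·K_π^{n+1}}(β_m) = β_n` for `n ≤ m` — an element of de Shalit's `𝒰 = lim← 𝒪(k_ξ^n)^×` over the base `k' = E`.
[cite: deShalit1987, Ch. I §2.2 Theorem] -/
structure RelNormCoherentUnits where
  /-- the components `β_m ∈ 𝒪_{E·K_π^{m+1}}` -/
  val : ∀ m : ℕ, unitBall (E ⊔ ltField π m : IntermediateField F (AlgebraicClosure F))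
  /-- each `β_m` is a unit -/
  norm_eq_one : ∀ m, ‖((val m : unitBall (E ⊔ ltField π m : IntermediateField F (AlgebraicClosure F))) :
    (E ⊔ ltField π m : IntermediateField F (AlgebraicClosure F)))‖ = 1
  /-- norm-coherence along the tower -/
  coherent : ∀ n m (hnm : n ≤ m),
    @Algebra.norm (E ⊔ ltField π n : IntermediateField F (AlgebraicClosure F))
        (E ⊔ ltField π m : IntermediateField F (AlgebraicClosure F)) _ _
        (towerAlgebra (sup_le_sup_left (ltField_mono hπ hnm) E))
        ((val m : unitBall (E ⊔ ltField π m : IntermediateField F (AlgebraicClosure F))) :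
          (E ⊔ ltField π m : IntermediateField F (AlgebraicClosure F))) =
      ((val n : unitBall (E ⊔ ltField π n : IntermediateField F (AlgebraicClosure F))) :
        (E ⊔ ltField π n : IntermediateField F (AlgebraicClosure F)))

namespace RelNormCoherentUnits

variable {hπ E}

/-- Two norm-coherent sequences with the same components are equal. [cite: deShalit1987, Ch. I §2.2] -/
@[ext] theorem ext {β β' : RelNormCoherentUnits hπ E} (h : ∀ m, β.val m = β'.val m) : β = β' := by
  cases β; cases β'; congr; exact funext h

/-- The termwise product (norms are multiplicative). [cite: deShalit1987, Ch. I §2.3 (i)] -/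
def mul (β β' : RelNormCoherentUnits hπ E) : RelNormCoherentUnits hπ E where
  val m := β.val m * β'.val m
  norm_eq_one m := by rw [Subring.coe_mul, norm_mul, β.norm_eq_one, β'.norm_eq_one, mul_one]
  coherent n m hnm := by
    letI := towerAlgebra (sup_le_sup_left (ltField_mono hπ hnm) E)
    rw [Subring.coe_mul, Subring.coe_mul, map_mul, β.coherent n m hnm, β'.coherent n m hnm]

/-- The constant sequence `1`. [cite: deShalit1987, Ch. I §2.3 (i)] -/
def one : RelNormCoherentUnits hπ E where
  val _ := 1
  norm_eq_one m := by rw [OneMemClass.coe_one, norm_one]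
  coherent n m hnm := by
    letI := towerAlgebra (sup_le_sup_left (ltField_mono hπ hnm) E)
    rw [OneMemClass.coe_one, OneMemClass.coe_one, map_one]

/-- Components of the product (unfolding). [cite: deShalit1987, Ch. I §2.3 (i)] -/
@[simp] theorem val_mul (β β' : RelNormCoherentUnits hπ E) (m : ℕ) : (β.mul β').val m = β.val m * β'.val m := rfl

/-- Components of `1` (unfolding). [cite: deShalit1987, Ch. I §2.3 (i)] -/
@[simp] theorem val_one (m : ℕ) : (one : RelNormCoherentUnits hπ E).val m = 1 := rfl

/-- **The stabiliser-product form of norm-coherence** (`E` Galois over `F`): `β` is norm-coherent in the sense of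
`IsRelNormCoherent` (`∏_{σ|_E = id, σ ω_{n+1} = ω_{n+1}} σ β_m = ι β_n`). [cite: deShalit1987, Ch. I §2.2 Theorem] -/
theorem isRelNormCoherent [IsGalois F E] (β : RelNormCoherentUnits hπ E) : IsRelNormCoherent hπ E β.val := by
  intro n m hnm
  rw [← algebraMap_towerNorm_sup_eq_prod_relStab hπ E m hnm, β.coherent n m hnm]
  rfl

end RelNormCoherentUnits

/-! ### The value of an `𝒪_E`-series at a point determines whether its constant term is a unit -/

variable {E} in
/-- **`‖G^ι(y)‖ = 1 ⟹ G(0) ∈ 𝒪_E^×`** for `G ∈ 𝒪_E⟦X⟧`, `E ≤ E'`, `y ∈ 𝔪_{E'}` (`G^ι(y) ≡ G(0)` modulo `𝔪_{E'}`).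
[cite: deShalit1987, Ch. I §2.2 Theorem (`g_β ∈ R^×`)] -/
theorem isUnit_constantCoeff_of_norm_evS_map_eq_one {E' : IntermediateField F (AlgebraicClosure F)} [FiniteDimensional F E']
    (h : E ≤ E') {G : PowerSeries (unitBall E)} (y : (maxNilIdeal F E').toIdeal)
    (hG : ‖((evS (maxNilIdeal F E') y (PowerSeries.map (inclUnitBall (F := F) h : unitBall E →+* unitBall E') G) :
      unitBall E') : E')‖ = 1) :
    IsUnit (PowerSeries.constantCoeff G) := by
  have hy : ‖((y : unitBall E') : E')‖ < 1 := y.2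
  -- `‖(G - C G₀)^ι(y)‖ ≤ ‖y‖ < 1`
  have h1 : ‖((evS (maxNilIdeal F E') y (PowerSeries.map (inclUnitBall (F := F) h : unitBall E →+* unitBall E')
      (G - PowerSeries.C (PowerSeries.constantCoeff G))) : unitBall E') : E')‖ ≤ ‖((y : unitBall E') : E')‖ := by
    change ‖((PowerSeries.aeval (isTopologicallyNilpotent_of_norm_lt_one E' hy)
      (PowerSeries.map (inclUnitBall (F := F) h : unitBall E →+* unitBall E')
        (G - PowerSeries.C (PowerSeries.constantCoeff G))) : unitBall E') : E')‖ ≤ _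
    refine norm_aeval_le_of_coeff_le (K := 1) _ hy (norm_nonneg _) (fun k hk => ?_) (by rw [pow_one])
    have hk0 : k = 0 := by omega
    subst hk0
    rw [PowerSeries.coeff_map, map_sub, PowerSeries.coeff_zero_eq_constantCoeff, PowerSeries.constantCoeff_C, sub_self,
      map_zero, ZeroMemClass.coe_zero, norm_zero]
    exact norm_nonneg _
  rw [map_sub, PowerSeries.map_C, map_sub, evS_C, AddSubgroupClass.coe_sub] at h1
  -- ultrametric: `‖G₀‖ = 1`
  set A := ((evS (maxNilIdeal F E') y (PowerSeries.map (inclUnitBall (F := F) h : unitBall E →+* unitBall E') G) :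
    unitBall E') : E') with hA
  set B := ((inclUnitBall (F := F) h (PowerSeries.constantCoeff G) : unitBall E') : E') with hB
  have hlt : ‖A - B‖ < 1 := lt_of_le_of_lt h1 hy
  have hne : ‖A‖ ≠ ‖-(A - B)‖ := by rw [norm_neg, hG]; exact (ne_of_lt hlt).symm
  have e : B = A + -(A - B) := by ring
  have h2 : ‖B‖ = 1 := by
    rw [e, IsUltrametricDist.norm_add_eq_max_of_norm_ne_norm hne, hG, norm_neg]
    exact max_eq_left hlt.le
  rw [hB, norm_inclUnitBall] at h2
  rw [Valuation.Integers.isUnit_iff_valuation_eq_one (Valuation.integer.integers (NormedField.valuation (K := E)))]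
  apply Subtype.ext
  change ‖((PowerSeries.constantCoeff G : unitBall E) : E)‖ = (1 : ℝ)
  exact h2

/-! ### The relative Coleman power series -/

variable [Normal F E]

/-- **Coleman's power series `g_β ∈ 𝒪_E⟦X⟧` of a norm-coherent sequence of units `β` along `E·K_π^{m+1}`** (`q = 2`,
`E ⊆ F^{nr}` finite Galois, `σ₀` an arithmetic Frobenius with restriction `φ` to `𝒪_E`): the unique series with
`((φ⁻¹)^{m+1} g_β)^ι(ω_{m+1}) = β_m` for all `m`. [cite: deShalit1987, Ch. I §2.2 Theorem] -/
def relColemanSeries [IsGalois F E] (hq : residueFieldCard F = 2) (hE : E ≤ maxUnramified F) {σ₀ : absoluteGaloisGroup F}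
    (hσ₀ : IsAbsArithFrob σ₀) (β : RelNormCoherentUnits hπ E) : PowerSeries (unitBall E) :=
  (exists_relColeman hπ hq hE hσ₀ β.val β.norm_eq_one β.isRelNormCoherent).choose

variable [IsGalois F E] (hq : residueFieldCard F = 2) (hE : E ≤ maxUnramified F) {σ₀ : absoluteGaloisGroup F}
  (hσ₀ : IsAbsArithFrob σ₀)

/-- ★ **`((φ⁻¹)^{m+1} g_β)^ι(ω_{m+1}) = β_m`** for every `m`. [cite: deShalit1987, Ch. I §2.2 Theorem] -/
theorem evS_relColemanSeries (β : RelNormCoherentUnits hπ E) (m : ℕ) :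
    evS (maxNilIdeal F (E ⊔ ltField π m : IntermediateField F (AlgebraicClosure F)))
        (inclPt (le_sup_right : ltField π m ≤ E ⊔ ltField π m) (cohPt hπ m))
        (PowerSeries.map (inclUnitBall (F := F) (le_sup_left : E ≤ E ⊔ ltField π m) :
          unitBall E →+* unitBall (E ⊔ ltField π m : IntermediateField F (AlgebraicClosure F)))
          ((PowerSeries.map ((frobUnitBall E σ₀).symm : unitBall E →+* unitBall E))^[m + 1]
            (relColemanSeries hπ E hq hE hσ₀ β))) = β.val m :=
  (exists_relColeman hπ hq hE hσ₀ β.val β.norm_eq_one β.isRelNormCoherent).choose_spec m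

/-- ★ **`𝒩_E g_β = g_β^φ`** (Cor. 2.3 (ii) over the unramified base). [cite: deShalit1987, Ch. I §2.3 (ii)] -/
theorem relNormTwo_relColemanSeries (β : RelNormCoherentUnits hπ E) :
    relNormTwo hπ E hq (relColemanSeries hπ E hq hE hσ₀ β) =
      PowerSeries.map (frobUnitBall E σ₀ : unitBall E →+* unitBall E) (relColemanSeries hπ E hq hE hσ₀ β) :=
  relNormTwo_eq_map_frob_of_forall_evS_eq hπ hq hE σ₀ β.val β.isRelNormCoherent (evS_relColemanSeries hπ E hq hE hσ₀ β)

/-- **Uniqueness**: a series whose twists take the values `β_m` at all `ω_{m+1}` is `g_β`. [cite: deShalit1987, Ch. I §2.2 Theorem] -/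
theorem eq_relColemanSeries {β : RelNormCoherentUnits hπ E} {g : PowerSeries (unitBall E)}
    (hg : ∀ m, evS (maxNilIdeal F (E ⊔ ltField π m : IntermediateField F (AlgebraicClosure F)))
        (inclPt (le_sup_right : ltField π m ≤ E ⊔ ltField π m) (cohPt hπ m))
        (PowerSeries.map (inclUnitBall (F := F) (le_sup_left : E ≤ E ⊔ ltField π m) :
          unitBall E →+* unitBall (E ⊔ ltField π m : IntermediateField F (AlgebraicClosure F)))
          ((PowerSeries.map ((frobUnitBall E σ₀).symm : unitBall E →+* unitBall E))^[m + 1] g)) = β.val m) :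
    g = relColemanSeries hπ E hq hE hσ₀ β :=
  eq_of_frequently_evS_symm_iterate_eq hπ hE ((absoluteGaloisGroup.toAlgEquiv F σ₀).restrictNormal E)
    (Filter.Frequently.of_forall fun m => by rw [← frobUnitBall, hg m, evS_relColemanSeries])

/-- **`g_β ∈ 𝒪_E⟦X⟧^×`**: its constant term is a unit (`‖β_0‖ = 1`). [cite: deShalit1987, Ch. I §2.2 Theorem] -/
theorem isUnit_constantCoeff_relColemanSeries (β : RelNormCoherentUnits hπ E) :
    IsUnit (PowerSeries.constantCoeff (relColemanSeries hπ E hq hE hσ₀ β)) := by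
  have h0 := isUnit_constantCoeff_of_norm_evS_map_eq_one (le_sup_left : E ≤ E ⊔ ltField π 0)
    (inclPt (le_sup_right : ltField π 0 ≤ E ⊔ ltField π 0) (cohPt hπ 0))
    (G := (PowerSeries.map ((frobUnitBall E σ₀).symm : unitBall E →+* unitBall E))^[0 + 1] (relColemanSeries hπ E hq hE hσ₀ β))
    (by rw [evS_relColemanSeries]; exact β.norm_eq_one 0)
  rw [Function.iterate_one, ← PowerSeries.coeff_zero_eq_constantCoeff_apply, PowerSeries.coeff_map,
    PowerSeries.coeff_zero_eq_constantCoeff_apply] at h0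
  have h1 := h0.map (frobUnitBall E σ₀ : unitBall E →+* unitBall E)
  rwa [show (frobUnitBall E σ₀ : unitBall E →+* unitBall E) (((frobUnitBall E σ₀).symm : unitBall E →+* unitBall E)
    (PowerSeries.constantCoeff (relColemanSeries hπ E hq hE hσ₀ β))) = PowerSeries.constantCoeff (relColemanSeries hπ E hq hE hσ₀ β)
    from (frobUnitBall E σ₀).apply_symm_apply _] at h1

/-- `g_β` is a unit of `𝒪_E⟦X⟧`. [cite: deShalit1987, Ch. I §2.2 Theorem] -/
theorem isUnit_relColemanSeries (β : RelNormCoherentUnits hπ E) : IsUnit (relColemanSeries hπ E hq hE hσ₀ β) :=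
  PowerSeries.isUnit_iff_constantCoeff.mpr (isUnit_constantCoeff_relColemanSeries hπ E hq hE hσ₀ β)

/-- ★ **`g_{ββ'} = g_β · g_{β'}`** (Cor. 2.3 (i)): the twists and the evaluations are multiplicative.
[cite: deShalit1987, Ch. I §2.3 (i)] -/
theorem relColemanSeries_mul (β β' : RelNormCoherentUnits hπ E) :
    relColemanSeries hπ E hq hE hσ₀ (β.mul β') = relColemanSeries hπ E hq hE hσ₀ β * relColemanSeries hπ E hq hE hσ₀ β' := by
  symm
  refine eq_relColemanSeries hπ E hq hE hσ₀ fun m => ?_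
  rw [map_iterate_mul, map_mul, map_mul, evS_relColemanSeries, evS_relColemanSeries, RelNormCoherentUnits.val_mul]

/-- `g_1 = 1`. [cite: deShalit1987, Ch. I §2.3 (i)] -/
theorem relColemanSeries_one : relColemanSeries hπ E hq hE hσ₀ (RelNormCoherentUnits.one : RelNormCoherentUnits hπ E) = 1 := by
  symm
  refine eq_relColemanSeries hπ E hq hE hσ₀ fun m => ?_
  have e1 : (PowerSeries.map ((frobUnitBall E σ₀).symm : unitBall E →+* unitBall E))^[m + 1] (1 : PowerSeries (unitBall E)) = 1 := by
    rw [← map_pow_eq_iterate, map_one]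
  rw [e1, map_one, map_one, RelNormCoherentUnits.val_one]

end RelativeSeriesTwo

end Literature.NumberTheory.GaloisRepresentations
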